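import Summits.QuantumFields.BalabanUV.Beta.FP.ShotBridge

/-!
# `BalabanUV.Beta.FP.ShotBridgeMean` — roads «FP» (d1-p3) and «BF-x» (d1-p2) for binder row D1: THE CROSS-ROAD BRIDGE AT THE MEAN GRADING
# (sibling of `FP/ShotBridge` p226410, owner ruling R-FP-14) — pure real analysis, no road object

HONEST FRAMING (cell contract, verbatim): «discharging `BetaPertH` makes Bałaban's UV stability UNCONDITIONAL — a real constructive-QFT
result; it is NOT the continuum limit and NOT the Clay problem.»  THIS MODULE DISCHARGES NOTHING: it is elementary sequence algebra about
four abstract real sequences (Cesàro means along arithmetic progressions).  READING (header only, never a hypothesis; as in `FP/ShotBridge`):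
`F₀ (Lc^k)` = road BF-x's level-0 one-shot coefficient at blocking `Lc^k`, `f j m` = road FP's finite-level (j, m) coefficient, `δ j m` = the
read-out defect of the TWO-STAGE telescoping `F₀(Lc^(j+m)) = F₀(Lc^j) + f j m + δ j m`, `fP m` = road FP's perfect coefficient (the `j → ∞`
limit, X1m), `s` = the value (`stepBal N Lc` at the roads' junction).
CONTENT:
* §0 [folklore] two sequence lemmas: `tendsto_inv_mul_sub_prog` (if `a k / k → s` then `n⁻¹·(a(n·m) − a 0) → m·s` for `m ≥ 1`) and
  `tendsto_div_of_abs_sub_le` (`|a k − k·s| ≤ C` ⟹ `a k / k → s`).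
* §1 **`hasym_of_cesaro_twoStage`** — road BF-x's MEAN grading `F₀(Lc^k)/k → s` (the Cesàro hypothesis shape of `D1BFx/RoadEnd.d1Drift_of_meanRoad`,
  weaker than the bounded form used in `ShotBridge.hasym_of_shot_twoStage`) + the two-stage telescoping with `|δ j m| ≤ D` + entrywise convergence
  `f j m → fP m` ⟹ road FP's (ASYMP) IN BOUNDED FORM WITH CONSTANT `D` ALONE: `∀ m ≥ 1, |fP m − m·s| ≤ D`.
  PROOF: along the progression `k = i·m` the Cesàro means of the `m`-step increments of `k ↦ F₀(Lc^k)` tend to `m·s`; those of `i ↦ f (i·m) m`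
  tend to `fP m` (Mathlib `Filter.Tendsto.cesaro`); hence the Cesàro means of the defects `δ (i·m) m` — each bounded by `D` — tend to `m·s − fP m`.
  COROLLARY **`hasym_of_shot_twoStage_sharp`**: under `ShotBridge.hasym_of_shot_twoStage`'s own bounded hypothesis `|F₀(Lc^k) − k·s| ≤ C` the
  constant `2C + D` improves to `D` (`C` drops out).  `D` cannot be improved (take `F₀ = 0`, `s = 0`, `f j m = D`, `δ j m = −D`).
* §2 **`cesaro_shot_of_tendsto`** — the mean twin of `ShotBridge.shot_bounded_of_value_rate`: `β j → s` (X1 WITHOUT a rate) + the one-stage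
  telescoping `F₀(Lc^k) = Σ_{j<k} β j + ε k` with a Cesàro-null defect `ε k / k → 0` ⟹ the mean law `F₀(Lc^k)/k → s`; and
  `cesaro_shot_of_value_rate`: `ShotBridge.shot_bounded_of_value_rate`'s hypotheses give the mean law too.
READING: R-FP-14's bridge connects road FP's (ASYMP) to BOTH gradings of road BF-x; at the mean grading the two-stage defect bound `D` is the
only constant that survives.  NOT «D1 closed», NOT BetaPertH, NOT continuum, NOT Clay.  [our object], Mathlib + `FP/ShotBridge` only,
0 `def`, 0 cite, 0 sorry.
HONEST DEPENDENCY (verbatim): «continuum YM on T⁴ ⇐ BetaPertH ∧ nine spine estimates (0/9 proved); BetaPertH ⇐ (D1) ∧ (D4) ∧ CAP+tail;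
G-an2-4 gates asym, D1 and NE2/3/4.»
Provenance: b2b-balaban-gan24-formalise-leaf-02 gen 33 (idle G-an2-4 swarm leaf seat, cross-lane for road FP; found while cross-reading
p226410), 2026-08-20 (claim table `LEAVES-FP.md` row FP-BFX-BRIDGE, sub-row BRIDGE-MEAN).
-/

namespace Summit.QuantumFields.BalabanUV.Beta.FP.ShotBridgeMean

open Filter Topology Finset

/-! ## §0 Two sequence lemmas -/

/-- [folklore] If `a k / k → s` then along the arithmetic progression `k = n·m` (`m ≥ 1`) the Cesàro means of the `m`-step increments
tend to `m·s`: `n⁻¹·(a(n·m) − a 0) → m·s`. -/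
theorem tendsto_inv_mul_sub_prog {a : ℕ → ℝ} {s : ℝ} (ha : Tendsto (fun k : ℕ => a k / (k : ℝ)) atTop (𝓝 s))
    {m : ℕ} (hm : 1 ≤ m) :
    Tendsto (fun n : ℕ => (n : ℝ)⁻¹ * (a (n * m) - a 0)) atTop (𝓝 ((m : ℝ) * s)) := by
  have hsub : Tendsto (fun n : ℕ => n * m) atTop atTop :=
    tendsto_atTop_mono (fun n => Nat.le_mul_of_pos_right n hm) tendsto_id
  have h2 : Tendsto (fun n : ℕ => (m : ℝ) * (a (n * m) / ((n * m : ℕ) : ℝ))) atTop (𝓝 ((m : ℝ) * s)) :=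
    (ha.comp hsub).const_mul _
  have h3 : Tendsto (fun n : ℕ => (n : ℝ)⁻¹ * a 0) atTop (𝓝 0) := by
    simpa using (tendsto_inv_atTop_nhds_zero_nat (𝕜 := ℝ)).mul_const (a 0)
  have h4 := h2.sub h3
  rw [sub_zero] at h4
  refine h4.congr' ?_
  filter_upwards [Ici_mem_atTop 1] with n hn
  have hn' : (n : ℝ) ≠ 0 := by exact_mod_cast Nat.one_le_iff_ne_zero.mp hn
  have hm' : (m : ℝ) ≠ 0 := by exact_mod_cast Nat.one_le_iff_ne_zero.mp hm
  rw [Nat.cast_mul]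
  field_simp

/-- [folklore] The bounded form implies the mean form: `|a k − k·s| ≤ C` for all `k` gives `a k / k → s`. -/
theorem tendsto_div_of_abs_sub_le {a : ℕ → ℝ} {s C : ℝ} (h : ∀ k : ℕ, |a k - (k : ℝ) * s| ≤ C) :
    Tendsto (fun k : ℕ => a k / (k : ℝ)) atTop (𝓝 s) := by
  have h0 : Tendsto (fun k : ℕ => C * (k : ℝ)⁻¹) atTop (𝓝 0) := by
    simpa using (tendsto_inv_atTop_nhds_zero_nat (𝕜 := ℝ)).const_mul C
  rw [← tendsto_sub_nhds_zero_iff]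
  refine squeeze_zero_norm' ?_ h0
  filter_upwards [Ici_mem_atTop 1] with k hk
  have hk' : (0 : ℝ) < k := by exact_mod_cast hk
  rw [Real.norm_eq_abs, show a k / (k : ℝ) - s = (a k - (k : ℝ) * s) * (k : ℝ)⁻¹ by field_simp]
  rw [abs_mul, abs_inv, abs_of_pos hk']
  gcongr
  exact h k

/-! ## §1 The mean grading of road BF-x ⟹ road FP's (ASYMP) with constant `D` -/

/-- [our object] **ROAD FP's (ASYMP) FROM ROAD BF-x's MEAN LAW**: the Cesàro form `F₀(Lc^k)/k → s` of the level-0 one-shot law, the two-stage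
telescoping identity with defects bounded by `D`, and entrywise convergence `f j m → fP m` (X1m) give `∀ m ≥ 1, |fP m − m·s| ≤ D`. -/
theorem hasym_of_cesaro_twoStage {F₀ : ℕ → ℝ} {f δ : ℕ → ℕ → ℝ} {fP : ℕ → ℝ} {s D : ℝ} {L : ℕ}
    (hT : Tendsto (fun k : ℕ => F₀ (L ^ k) / (k : ℝ)) atTop (𝓝 s))
    (htel : ∀ j m : ℕ, F₀ (L ^ (j + m)) = F₀ (L ^ j) + f j m + δ j m)
    (hδ : ∀ j m : ℕ, |δ j m| ≤ D) (hlim : ∀ m : ℕ, Tendsto (fun j => f j m) atTop (𝓝 (fP m))) :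
    ∀ m : ℕ, 1 ≤ m → |fP m - (m : ℝ) * s| ≤ D := by
  intro m hm
  -- (1) the Cesàro means of the `m`-step increments of `k ↦ F₀ (L^k)` along `k = i·m` tend to `m·s`
  have h1 : Tendsto (fun n : ℕ => (n : ℝ)⁻¹ * (F₀ (L ^ (n * m)) - F₀ (L ^ 0))) atTop (𝓝 ((m : ℝ) * s)) :=
    tendsto_inv_mul_sub_prog (a := fun k => F₀ (L ^ k)) hT hm
  -- (2) the Cesàro means of `i ↦ f (i·m) m` tend to `fP m`
  have hsub : Tendsto (fun i : ℕ => i * m) atTop atTop :=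
    tendsto_atTop_mono (fun i => Nat.le_mul_of_pos_right i hm) tendsto_id
  have h2 : Tendsto (fun n : ℕ => (n : ℝ)⁻¹ * ∑ i ∈ range n, f (i * m) m) atTop (𝓝 (fP m)) :=
    ((hlim m).comp hsub).cesaro
  -- (3) the defects telescope: `Σ_{i<n} δ (i·m) m = (F₀ (L^(n·m)) − F₀ (L^0)) − Σ_{i<n} f (i·m) m`
  have hδsum : ∀ n : ℕ, ∑ i ∈ range n, δ (i * m) m
      = (F₀ (L ^ (n * m)) - F₀ (L ^ 0)) - ∑ i ∈ range n, f (i * m) m := by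
    intro n
    have hδi : ∀ i : ℕ, δ (i * m) m = (F₀ (L ^ ((i + 1) * m)) - F₀ (L ^ (i * m))) - f (i * m) m := by
      intro i
      have e := htel (i * m) m
      rw [show i * m + m = (i + 1) * m by ring] at e
      linarith
    have tel : ∑ i ∈ range n, (F₀ (L ^ ((i + 1) * m)) - F₀ (L ^ (i * m))) = F₀ (L ^ (n * m)) - F₀ (L ^ (0 * m)) :=
      Finset.sum_range_sub (fun i => F₀ (L ^ (i * m))) n
    rw [zero_mul] at tel
    simp_rw [hδi]
    rw [sum_sub_distrib, tel]
  -- (4) hence the Cesàro means of the defects tend to `m·s − fP m` …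
  have h3 : Tendsto (fun n : ℕ => (n : ℝ)⁻¹ * ∑ i ∈ range n, δ (i * m) m) atTop (𝓝 ((m : ℝ) * s - fP m)) := by
    refine (h1.sub h2).congr' (Eventually.of_forall fun n => ?_)
    show (n : ℝ)⁻¹ * (F₀ (L ^ (n * m)) - F₀ (L ^ 0)) - (n : ℝ)⁻¹ * ∑ i ∈ range n, f (i * m) m
      = (n : ℝ)⁻¹ * ∑ i ∈ range n, δ (i * m) m
    rw [hδsum n]
    ring
  -- (5) … while each of them is bounded by `D`
  have hD0 : 0 ≤ D := (abs_nonneg _).trans (hδ 0 0)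
  have h4 : ∀ n : ℕ, |(n : ℝ)⁻¹ * ∑ i ∈ range n, δ (i * m) m| ≤ D := by
    intro n
    rcases Nat.eq_zero_or_pos n with rfl | hn
    · simp [hD0]
    have hn' : (0 : ℝ) < n := by exact_mod_cast hn
    rw [abs_mul, abs_inv, abs_of_pos hn']
    calc (n : ℝ)⁻¹ * |∑ i ∈ range n, δ (i * m) m|
        ≤ (n : ℝ)⁻¹ * ∑ i ∈ range n, |δ (i * m) m| := by gcongr; exact abs_sum_le_sum_abs _ _
      _ ≤ (n : ℝ)⁻¹ * ∑ i ∈ range n, D := by gcongr with i _; exact hδ _ _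
      _ = D := by rw [sum_const, card_range, nsmul_eq_mul]; field_simp
  -- (6) pass to the limit
  have h5 : |(m : ℝ) * s - fP m| ≤ D := le_of_tendsto' h3.abs h4
  rwa [abs_sub_comm] at h5

/-- [our object] **SHARP FORM OF `ShotBridge.hasym_of_shot_twoStage`**: under the bounded level-0 law `|F₀(Lc^k) − k·s| ≤ C` the conclusion holds
with constant `D` (not `2C + D`): the level-0 constant `C` drops out entirely. -/
theorem hasym_of_shot_twoStage_sharp {F₀ : ℕ → ℝ} {f δ : ℕ → ℕ → ℝ} {fP : ℕ → ℝ} {s C D : ℝ} {L : ℕ}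
    (hT : ∀ k : ℕ, |F₀ (L ^ k) - (k : ℝ) * s| ≤ C)
    (htel : ∀ j m : ℕ, F₀ (L ^ (j + m)) = F₀ (L ^ j) + f j m + δ j m)
    (hδ : ∀ j m : ℕ, |δ j m| ≤ D) (hlim : ∀ m : ℕ, Tendsto (fun j => f j m) atTop (𝓝 (fP m))) :
    ∀ m : ℕ, 1 ≤ m → |fP m - (m : ℝ) * s| ≤ D :=
  hasym_of_cesaro_twoStage (tendsto_div_of_abs_sub_le hT) htel hδ hlim

/-! ## §2 The mean twin of the converse: road FP's value without a rate ⟹ road BF-x's mean law -/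

/-- [our object] **ROAD BF-x's MEAN LAW FROM ROAD FP's VALUE (no rate needed)**: if the one-step coefficients converge, `β j → s`, and the level-0
one-shot telescopes as `F₀(Lc^k) = Σ_{j<k} β j + ε k` with a Cesàro-null cumulative defect `ε k / k → 0`, then `F₀(Lc^k)/k → s`. -/
theorem cesaro_shot_of_tendsto {F₀ β ε : ℕ → ℝ} {s : ℝ} {L : ℕ}
    (hβ : Tendsto β atTop (𝓝 s))
    (htel : ∀ k : ℕ, F₀ (L ^ k) = ∑ j ∈ range k, β j + ε k)
    (hε : Tendsto (fun k : ℕ => ε k / (k : ℝ)) atTop (𝓝 0)) :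
    Tendsto (fun k : ℕ => F₀ (L ^ k) / (k : ℝ)) atTop (𝓝 s) := by
  have h := hβ.cesaro.add hε
  rw [add_zero] at h
  refine h.congr' (Eventually.of_forall fun k => ?_)
  show (k : ℝ)⁻¹ * ∑ j ∈ range k, β j + ε k / (k : ℝ) = F₀ (L ^ k) / (k : ℝ)
  rw [htel k]
  ring

/-- [our object] In particular `ShotBridge.shot_bounded_of_value_rate`'s hypotheses (value + geometric rate + bounded cumulative defect) give
the mean law `F₀(Lc^k)/k → s` (through its bounded conclusion and `tendsto_div_of_abs_sub_le`). -/
theorem cesaro_shot_of_value_rate {F₀ β ε : ℕ → ℝ} {s c θ E : ℝ} {L : ℕ}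
    (hβ : ∀ j : ℕ, |β j - s| ≤ c * θ ^ j) (hc : 0 ≤ c) (hθ0 : 0 ≤ θ) (hθ1 : θ < 1)
    (htel : ∀ k : ℕ, F₀ (L ^ k) = ∑ j ∈ range k, β j + ε k) (hε : ∀ k : ℕ, |ε k| ≤ E) :
    Tendsto (fun k : ℕ => F₀ (L ^ k) / (k : ℝ)) atTop (𝓝 s) :=
  tendsto_div_of_abs_sub_le (C := c / (1 - θ) + E)
    (ShotBridge.shot_bounded_of_value_rate hβ hc hθ0 hθ1 htel hε)

end Summit.QuantumFields.BalabanUV.Beta.FP.ShotBridgeMean
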